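import Mathlib
import Summits.MatrixMultiplication.MatrixMultiplication.Theorems.SnSubsetDichotomyHyperoctahedralThresholdRotationIdentity

/-!
# Same-colour reflection collisions avoiding a forbidden set (crux `HyperoctahedralThreshold`, stmt-10883)

Helper for the open core `stub_poorRigidCore` of the refutation line `refutation-local-symmetry`
(skeleton `Cruxes/HyperoctahedralThreshold/Lines/refutation_local_symmetry.lean`), siege variation
"supply/tip dichotomy", file 1 of 2 (`…SameColourCollision` ⊢ `…SameColourAvoiding`):
the tip-free currency of the reflection route (crux NOTES §15.1) are SAME-colour reflection structures, and this
file supplies their raw material in the presence of a forbidden set `R`.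

Vocabulary of the line: three fixed-point-free involutions `μ c` of `Fin n`; a colour word acts on the right,
`x · w := w.foldl (fun v c => μ c v) x` (lemmas `Rotation.foldl_act_*` of the landed `…RotationIdentity`, p111510).
An involution word `w ++ 0 :: w.reverse` acts as a conjugate of `μ 0`, hence moves every point.

* `family_spec` — an explicit injective family of `2^L` words `w` of length `L` with `w ++ [0]` reduced
  (`scanl` of a bit string; the construction of the sibling file `…ReflectionSupply`, siege k19, bundled here
  into one existence statement).
* `exists_sameColour_collision_avoiding` — if `n (n - 1) + 2^L (2L + 2) |R| < 2^L n`, some vertex `v` carries two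
  DISTINCT words `w ≠ w'` of the family whose involution words OF THE SAME COLOUR `0` collide at `v`,
  `v · (w 0 w⁻¹) = v · (w' 0 w'⁻¹)`, all trajectory points of both from `v` lying outside `R`.  Proof (as in
  `…ReflectionSupply`, whose exported statement `(w ≠ w' ∨ c ≠ c')` forgets that its two colliding involution
  words have the same middle colour — the one bit the tip-free route needs): for a fixed word and time the
  trajectory point is an injective function of the start, so at most `2^L (2L+2) |R|` pairs (start, word) meet `R`;
  hence some `v` has `≥ n` words with `R`-free trajectories, and two of them collide in `Fin n ∖ {v}` (pigeonhole).
Pure finite combinatorics; no definitions are introduced.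
-/

set_option linter.dupNamespace false

namespace Summit.MatrixMultiplication.MatrixMultiplication.Theorems.HyperoctahedralThreshold.SameColourCollision

open Finset

variable {n : ℕ}

-- construction adapted from the sibling tree file …ReflectionSupply.lean (siege k19), bundled
/-- **A family of `2^L` reduced words.**  There is an injective map `F` from bit strings of length `L` to colour
words of length `L` such that `F bs ++ [0]` is reduced for every `bs` (take `F bs :=` the reversed tail of
`List.scanl (fun x b => if b then x + 1 else x + 2) 0 bs`). -/
theorem family_spec (L : ℕ) : ∃ F : List.Vector Bool L → List (Fin 3), Function.Injective F ∧
    ∀ bs, (F bs).length = L ∧ List.IsChain (· ≠ ·) (F bs ++ [0]) := by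
  have step_ne : ∀ (x : Fin 3) (b : Bool), (if b then x + 1 else x + 2) ≠ x := by decide
  have step_inj : ∀ (x : Fin 3) (b b' : Bool),
      (if b then x + 1 else x + 2) = (if b' then x + 1 else x + 2) → b = b' := by decide
  have scanl_eq_cons : ∀ (a : Fin 3) (bs : List Bool),
      ∃ l, List.scanl (fun x b => if b then x + 1 else x + 2) a bs = a :: l := by
    intro a bs
    cases bs with
    | nil => exact ⟨[], by simp⟩
    | cons b bs => exact ⟨_, List.scanl_cons⟩
  have isChain_scanl : ∀ (bs : List Bool) (a : Fin 3),
      List.IsChain (· ≠ ·) (List.scanl (fun x b => if b then x + 1 else x + 2) a bs) := by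
    intro bs
    induction bs with
    | nil => intro a; simp
    | cons b bs ih =>
      intro a
      rw [List.scanl_cons]
      refine List.IsChain.cons (ih _) ?_
      intro y hy
      obtain ⟨l, hl⟩ := scanl_eq_cons (if b then a + 1 else a + 2) bs
      rw [hl] at hy
      simp only [List.head?_cons, Option.mem_def, Option.some.injEq] at hy
      rw [← hy]
      exact (step_ne a b).symm
  have scanl_injective : ∀ (bs bs' : List Bool) (a : Fin 3),
      List.scanl (fun x b => if b then x + 1 else x + 2) a bs =
        List.scanl (fun x b => if b then x + 1 else x + 2) a bs' → bs = bs' := by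
    intro bs
    induction bs with
    | nil =>
      intro bs' a h
      cases bs' with
      | nil => rfl
      | cons b' bs' =>
        have := congrArg List.length h
        simp [List.length_scanl] at this
    | cons b bs ih =>
      intro bs' a h
      cases bs' with
      | nil =>
        have := congrArg List.length h
        simp [List.length_scanl] at this
      | cons b' bs' =>
        rw [List.scanl_cons, List.scanl_cons] at h
        have htl := List.tail_eq_of_cons_eq h
        obtain ⟨l, hl⟩ := scanl_eq_cons (if b then a + 1 else a + 2) bs
        obtain ⟨l', hl'⟩ := scanl_eq_cons (if b' then a + 1 else a + 2) bs'
        have hhd : (if b then a + 1 else a + 2) = (if b' then a + 1 else a + 2) := by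
          have := congrArg List.head? htl
          rw [hl, hl'] at this
          simpa using this
        have hb : b = b' := step_inj a b b' hhd
        subst hb
        rw [ih bs' _ htl]
  refine ⟨fun bs => (List.scanl (fun x b => if b then x + 1 else x + 2) (0 : Fin 3) bs.toList).tail.reverse,
    ?_, fun bs => ⟨by simp [List.length_scanl], ?_⟩⟩
  · intro bs bs' h
    obtain ⟨l, hl⟩ := scanl_eq_cons 0 bs.toList
    obtain ⟨l', hl'⟩ := scanl_eq_cons 0 bs'.toList
    have h1 := congrArg List.reverse h
    simp only [List.reverse_reverse] at h1
    rw [hl, hl'] at h1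
    simp only [List.tail_cons] at h1
    subst h1
    exact List.Vector.toList_injective (scanl_injective _ _ _ (hl.trans hl'.symm))
  · beta_reduce
    obtain ⟨l, hl⟩ := scanl_eq_cons 0 bs.toList
    have hc := isChain_scanl bs.toList 0
    rw [hl] at hc ⊢
    have : (0 :: l).tail.reverse ++ [(0 : Fin 3)] = (0 :: l).reverse := by simp
    rw [this, List.isChain_reverse]
    exact hc.imp (fun a b h => fun h' => h h'.symm)

/-- **Same-colour reflection collision avoiding a forbidden set.**  If `n(n-1) + 2^L (2L+2) |R| < 2^L n`, some
vertex `v` carries two DISTINCT words `w ≠ w'` of length `L` (`w ++ [0]`, `w' ++ [0]` reduced) whose involution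
words of the SAME colour `0` collide at `v`, `v · (w 0 w⁻¹) = v · (w' 0 w'⁻¹)`, with all trajectory points of both
involution words from `v` outside `R`. -/
theorem exists_sameColour_collision_avoiding (μ : Fin 3 → Equiv.Perm (Fin n)) (hμ : ∀ c, μ c * μ c = 1)
    (hfpf : ∀ c v, μ c v ≠ v) {L : ℕ} (R : Finset (Fin n))
    (hL : n * (n - 1) + 2 ^ L * ((2 * L + 2) * R.card) < 2 ^ L * n) :
    ∃ (v : Fin n) (w w' : List (Fin 3)), w ≠ w' ∧ w.length = L ∧ w'.length = L ∧
      List.IsChain (· ≠ ·) (w ++ [0]) ∧ List.IsChain (· ≠ ·) (w' ++ [0]) ∧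
      (w ++ 0 :: w.reverse).foldl (fun v c => μ c v) v =
        (w' ++ 0 :: w'.reverse).foldl (fun v c => μ c v) v ∧
      (∀ t, ((w ++ 0 :: w.reverse).take t).foldl (fun v c => μ c v) v ∉ R) ∧
      (∀ t, ((w' ++ 0 :: w'.reverse).take t).foldl (fun v c => μ c v) v ∉ R) := by
  classical
  obtain ⟨F, hFinj, hF⟩ := family_spec L
  -- involution words move every point (they act as conjugates of `μ 0`)
  have hmove : ∀ (w : List (Fin 3)) (v : Fin n), (w ++ 0 :: w.reverse).foldl (fun v c => μ c v) v ≠ v := by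
    intro w v h
    rw [List.foldl_append, List.foldl_cons] at h
    have h' := congrArg (fun x => w.foldl (fun v c => μ c v) x) h
    simp only [Rotation.foldl_reverse_act μ hμ] at h'
    exact hfpf 0 _ h'
  set ι : List.Vector Bool L → List (Fin 3) := fun bs => F bs ++ (0 : Fin 3) :: (F bs).reverse with hι
  have hιlen : ∀ bs, (ι bs).length = 2 * L + 1 := by
    intro bs
    simp only [hι, List.length_append, List.length_cons, List.length_reverse, (hF bs).1]
    omega
  set good : Fin n → List.Vector Bool L → Prop := fun v bs =>
    ∀ t, t < 2 * L + 2 → ((ι bs).take t).foldl (fun v c => μ c v) v ∉ R with hgood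
  -- (1) bijection trick: for fixed `bs, t` at most `|R|` starting points have their `t`-th point in `R`
  have hfib : ∀ (bs : List.Vector Bool L) (t : ℕ),
      ((Finset.univ : Finset (Fin n)).filter
        (fun v => ((ι bs).take t).foldl (fun v c => μ c v) v ∈ R)).card ≤ R.card := by
    intro bs t
    refine Finset.card_le_card_of_injOn (fun v => ((ι bs).take t).foldl (fun v c => μ c v) v) ?_ ?_
    · intro v hv
      simpa using hv
    · intro v _ v' _ hvv'
      exact Rotation.foldl_act_injective μ hμ _ hvv'
  -- (2) the bad pairs are few in total
  have hbad : ∑ v : Fin n, ((Finset.univ : Finset (List.Vector Bool L)).filter (fun bs => ¬ good v bs)).card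
      ≤ 2 ^ L * ((2 * L + 2) * R.card) := by
    calc ∑ v : Fin n, ((Finset.univ : Finset (List.Vector Bool L)).filter (fun bs => ¬ good v bs)).card
        ≤ ∑ v : Fin n, ∑ bs : List.Vector Bool L, ∑ t ∈ Finset.range (2 * L + 2),
            (if ((ι bs).take t).foldl (fun v c => μ c v) v ∈ R then 1 else 0) := by
          refine Finset.sum_le_sum fun v _ => ?_
          rw [Finset.card_filter]
          refine Finset.sum_le_sum fun bs _ => ?_
          by_cases hb : ¬ good v bs
          · rw [if_pos hb]
            simp only [hgood, not_forall, not_not, exists_prop] at hb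
            obtain ⟨t, ht, htR⟩ := hb
            have h1 := Finset.single_le_sum (f := fun t =>
              if ((ι bs).take t).foldl (fun v c => μ c v) v ∈ R then 1 else 0)
              (fun _ _ => Nat.zero_le _) (Finset.mem_range.2 ht)
            rw [if_pos htR] at h1
            exact h1
          · rw [if_neg hb]
            exact Nat.zero_le _
      _ = ∑ bs : List.Vector Bool L, ∑ t ∈ Finset.range (2 * L + 2), ∑ v : Fin n,
            (if ((ι bs).take t).foldl (fun v c => μ c v) v ∈ R then 1 else 0) := by
          rw [Finset.sum_comm]
          exact Finset.sum_congr rfl fun bs _ => Finset.sum_comm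
      _ ≤ ∑ bs : List.Vector Bool L, ∑ t ∈ Finset.range (2 * L + 2), R.card := by
          refine Finset.sum_le_sum fun bs _ => Finset.sum_le_sum fun t _ => ?_
          rw [← Finset.card_filter]
          exact hfib bs t
      _ = 2 ^ L * ((2 * L + 2) * R.card) := by
          simp [Finset.sum_const, Finset.card_univ, card_vector, Fintype.card_bool]
  -- (3) some vertex has at least `n` good words
  have hv : ∃ v : Fin n, n - 1 <
      ((Finset.univ : Finset (List.Vector Bool L)).filter (fun bs => good v bs)).card := by
    by_contra hcon
    push Not at hcon
    have hsplit : ∀ v : Fin n,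
        ((Finset.univ : Finset (List.Vector Bool L)).filter (fun bs => good v bs)).card +
          ((Finset.univ : Finset (List.Vector Bool L)).filter (fun bs => ¬ good v bs)).card = 2 ^ L := by
      intro v
      rw [Finset.card_filter_add_card_filter_not, Finset.card_univ, card_vector, Fintype.card_bool]
    have hsum : ∑ v : Fin n, (2 ^ L) ≤ n * (n - 1) + 2 ^ L * ((2 * L + 2) * R.card) := by
      calc ∑ v : Fin n, (2 ^ L)
          = ∑ v : Fin n, (((Finset.univ : Finset (List.Vector Bool L)).filter (fun bs => good v bs)).card +
              ((Finset.univ : Finset (List.Vector Bool L)).filter (fun bs => ¬ good v bs)).card) :=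
            Finset.sum_congr rfl fun v _ => (hsplit v).symm
        _ = ∑ v : Fin n, ((Finset.univ : Finset (List.Vector Bool L)).filter (fun bs => good v bs)).card +
              ∑ v : Fin n, ((Finset.univ : Finset (List.Vector Bool L)).filter (fun bs => ¬ good v bs)).card :=
            Finset.sum_add_distrib
        _ ≤ ∑ v : Fin n, (n - 1) + 2 ^ L * ((2 * L + 2) * R.card) :=
            Nat.add_le_add (Finset.sum_le_sum fun v _ => hcon v) hbad
        _ = n * (n - 1) + 2 ^ L * ((2 * L + 2) * R.card) := by
            simp [Finset.sum_const, Finset.card_univ, Fintype.card_fin]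
    have : ∑ v : Fin n, (2 ^ L) = 2 ^ L * n := by
      simp [Finset.sum_const, Finset.card_univ, Fintype.card_fin, mul_comm]
    omega
  obtain ⟨v, hv⟩ := hv
  -- (4) pigeonhole among the good words at `v`
  have hmaps : Set.MapsTo (fun bs => (ι bs).foldl (fun v c => μ c v) v)
      ↑((Finset.univ : Finset (List.Vector Bool L)).filter (fun bs => good v bs))
      ↑((Finset.univ : Finset (Fin n)).erase v) := by
    intro bs _
    simp only [Finset.coe_erase, Finset.coe_univ, Set.mem_sdiff, Set.mem_univ, Set.mem_singleton_iff,
      true_and]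
    exact hmove _ _
  have hcard : ((Finset.univ : Finset (Fin n)).erase v).card <
      ((Finset.univ : Finset (List.Vector Bool L)).filter (fun bs => good v bs)).card := by
    rw [Finset.card_erase_of_mem (Finset.mem_univ v), Finset.card_univ, Fintype.card_fin]
    exact hv
  obtain ⟨bs, hbs, bs', hbs', hne, heq⟩ := Finset.exists_ne_map_eq_of_card_lt_of_maps_to hcard hmaps
  rw [Finset.mem_filter] at hbs hbs'
  -- from the first `2L+2` points to all `t`
  have hall : ∀ bs, good v bs → ∀ t, ((ι bs).take t).foldl (fun v c => μ c v) v ∉ R := by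
    intro bs hg t
    by_cases ht : t < 2 * L + 2
    · exact hg t ht
    · have h1 : (ι bs).take t = ι bs := List.take_of_length_le (by rw [hιlen]; omega)
      have h2 : (ι bs).take (2 * L + 1) = ι bs := List.take_of_length_le (by rw [hιlen])
      rw [h1, ← h2]
      exact hg (2 * L + 1) (by omega)
  exact ⟨v, F bs, F bs', fun h => hne (hFinj h), (hF bs).1, (hF bs').1, (hF bs).2, (hF bs').2, heq,
    hall bs hbs.2, hall bs' hbs'.2⟩

/-- **Registered form** (`stub_sameColourCollision`, a `--supports` sub-goal of crux stmt-MatrixMultiplication-10883,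
siege variation "supply/tip dichotomy"): verbatim `exists_sameColour_collision_avoiding`. -/
theorem stub_sameColourCollision : ∀ (n L : ℕ) (μ : Fin 3 → Equiv.Perm (Fin n)) (R : Finset (Fin n)), (∀ c, μ c * μ c = 1) → (∀ c v, μ c v ≠ v) → n * (n - 1) + 2 ^ L * ((2 * L + 2) * R.card) < 2 ^ L * n → ∃ (v : Fin n) (w w' : List (Fin 3)), w ≠ w' ∧ w.length = L ∧ w'.length = L ∧ List.IsChain (· ≠ ·) (w ++ [0]) ∧ List.IsChain (· ≠ ·) (w' ++ [0]) ∧ (w ++ 0 :: w.reverse).foldl (fun v c => μ c v) v = (w' ++ 0 :: w'.reverse).foldl (fun v c => μ c v) v ∧ (∀ t, ((w ++ 0 :: w.reverse).take t).foldl (fun v c => μ c v) v ∉ R) ∧ (∀ t, ((w' ++ 0 :: w'.reverse).take t).foldl (fun v c => μ c v) v ∉ R) :=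
  fun _n _L μ R hμ hfpf hL => exists_sameColour_collision_avoiding μ hμ hfpf R hL

end Summit.MatrixMultiplication.MatrixMultiplication.Theorems.HyperoctahedralThreshold.SameColourCollision
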